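import Summits.AtomisticToContinuum.Crystallization.Theorems.ChartedZeroExcessLayeredLatticeLiouvilleZZZYRCQ

/-!
# Charted zero-excess layered-lattice Liouville — ZZZYRCR: the far-remainder SERIES in closed form (K-file reader lemma)

Cell `decomp-a2c`, lens 2, generation 99.  `schemeDominatedOnP_remainder_king_typed` (ZZZYRCQ) leaves the K-file one hypothesis
`hθ : ∀ N, Σ_{n ∈ Ico nD N} M n · 7n / max(D, c₀ n)⁸ ≤ θ` with `M n = 2n(n+1)(2n+1)/3`.  This file discharges it down to ONE closed
numeric inequality (`norm_num` at rational `D, c₀`): split the series at any `n₁ ≥ max(2, nD)` (optimal `n₁ = ⌈D / c₀⌉`),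

* `n < n₁`: `max ≥ D`, a FINITE sum `Σ_{n ∈ Ico nD n₁} M n · 7n / D⁸`;
* `n ≥ n₁`: `max ≥ c₀ n`, `M n · 7n / (c₀ n)⁸ = 14 (n+1)(2n+1) / (3 c₀⁸ n²) · n⁻⁴ ≤ 14 (n₁+1)(2n₁+1) / (3 c₀⁸ n₁²) · n⁻⁴` and the telescoping
  tail `Σ_{n ≥ n₁} n⁻⁴ ≤ 1 / (3 (n₁ − 1)³)` (`sum_Ico_inv_pow4_le`: `n⁻⁴ ≤ (3(n−1)³)⁻¹ − (3n³)⁻¹`).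

★ `king_typed_series_le` — the split bound; ★★ `schemeDominatedOnP_remainder_king_far` — the CLUSTER-ID far remainder with hypothesis
`Σ_{n ∈ Ico nD n₁} M n · 7n / D⁸ + 14 (n₁+1)(2n₁+1) / (9 c₀⁸ n₁² (n₁−1)³) ≤ θ` only.  Loss vs the exact series: 3 % at `D = 32`
(`(D, c₀) = (32, 0.74)`: `nD = 9`, `n₁ = 44`, finite part `2.76e-4` + tail `4.50e-4` = `7.26e-4` vs exact `7.07e-4`; `(32, 0.80)`: `n₁ = 40`,
`1.71e-4 + 3.24e-4 = 4.95e-4`; `(17, 0.74)`: `5.1e-3`; `(48, 0.74)`: `2.1e-4`) — memo NODE-g99 §8.6.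

Theorem file (0 def, 4 theorems); imports ZZZYRCQ; no instance / notation / option; 0 sorry. [g99]
-/

open scoped BigOperators

namespace Summit.AtomisticToContinuum.Crystallization.Theorems.ChartedZeroExcessLayeredLatticeLiouville

open Summit.AtomisticToContinuum.Crystallization.Theorems.ChartedPlanarOrderRigidityDoor (E3)

/-- the telescoping step `x⁻⁴ ≤ (3(x−1)³)⁻¹ − (3x³)⁻¹` for `x ≥ 2`. [g99] -/
theorem inv_pow4_le_sub {x : ℝ} (hx : 2 ≤ x) : ((x ^ 4)⁻¹ : ℝ) ≤ 1 / (3 * (x - 1) ^ 3) - 1 / (3 * x ^ 3) := by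
  have hx0 : x ≠ 0 := (by linarith : (0 : ℝ) < x).ne'
  have hx1' : (0 : ℝ) < x - 1 := by linarith
  have hx1 : x - 1 ≠ 0 := hx1'.ne'
  have key : 1 / (3 * (x - 1) ^ 3) - 1 / (3 * x ^ 3) - (x ^ 4)⁻¹ = (6 * x ^ 2 - 8 * x + 3) / (3 * x ^ 4 * (x - 1) ^ 3) := by
    field_simp
    ring
  have hnum : (0 : ℝ) ≤ (6 * x ^ 2 - 8 * x + 3) / (3 * x ^ 4 * (x - 1) ^ 3) :=
    div_nonneg (by nlinarith [sq_nonneg (x - 2 / 3)]) (by positivity)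
  linarith

/-- the tail of `Σ n⁻⁴`: `Σ_{n ∈ Ico (m+1) N} n⁻⁴ ≤ 1 / (3 m³)` for `m ≥ 1` and every `N`. [g99] -/
theorem sum_Ico_inv_pow4_le (m : ℕ) (hm : 1 ≤ m) (N : ℕ) :
    ∑ n ∈ Finset.Ico (m + 1) N, (((n : ℝ) ^ 4)⁻¹ : ℝ) ≤ 1 / (3 * (m : ℝ) ^ 3) := by
  have hm0 : (0 : ℝ) < m := by exact_mod_cast hm
  by_cases hN : N ≤ m + 1
  · rw [Finset.Ico_eq_empty_of_le hN, Finset.sum_empty]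
    positivity
  · have key : ∀ K, m + 1 ≤ K →
        ∑ n ∈ Finset.Ico (m + 1) K, (((n : ℝ) ^ 4)⁻¹ : ℝ) ≤ 1 / (3 * (m : ℝ) ^ 3) - 1 / (3 * ((K : ℝ) - 1) ^ 3) := by
      intro K hK
      induction K, hK using Nat.le_induction with
      | base =>
        have e : ((m + 1 : ℕ) : ℝ) - 1 = m := by push_cast; ring
        rw [Finset.Ico_self, Finset.sum_empty, e]
        linarith
      | succ K hK ih =>
        rw [Finset.sum_Ico_succ_top hK]
        have hK2 : (2 : ℝ) ≤ K := by exact_mod_cast (show 2 ≤ K by omega)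
        have step := inv_pow4_le_sub hK2
        have e : ((K + 1 : ℕ) : ℝ) - 1 = K := by push_cast; ring
        rw [e]
        linarith
    have h := key N (by omega)
    have h3 : (3 : ℝ) ≤ N := by exact_mod_cast (show 3 ≤ N by omega)
    have hpos : (0 : ℝ) ≤ 1 / (3 * ((N : ℝ) - 1) ^ 3) := by
      have : (0 : ℝ) < (N : ℝ) - 1 := by linarith
      positivity
    linarith

/-- ★ **THE SPLIT BOUND** for the typed king series: finite part below `n₁` (with `max ≥ D`) plus the closed-form tail (with `max ≥ c₀ n`);
valid for ANY split point `n₁ ≥ max(2, nD)`, optimal at `n₁ = ⌈D / c₀⌉`. [g99] -/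
theorem king_typed_series_le {D c₀ : ℝ} (hD : 0 < D) (hc : 0 < c₀) {nD n₁ : ℕ} (h2 : 2 ≤ n₁) (hnD : nD ≤ n₁) (N : ℕ) :
    ∑ n ∈ Finset.Ico nD N, (2 * (n : ℝ) * (n + 1) * (2 * n + 1) / 3) * (7 * (n : ℝ) / max D (c₀ * n) ^ 8) ≤
      ∑ n ∈ Finset.Ico nD n₁, (2 * (n : ℝ) * (n + 1) * (2 * n + 1) / 3) * (7 * (n : ℝ) / D ^ 8) +
        14 * ((n₁ : ℝ) + 1) * (2 * n₁ + 1) / (9 * c₀ ^ 8 * (n₁ : ℝ) ^ 2 * ((n₁ : ℝ) - 1) ^ 3) := by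
  have hn10 : (0 : ℝ) < n₁ := by exact_mod_cast (show 0 < n₁ by omega)
  have hn11 : (0 : ℝ) < (n₁ : ℝ) - 1 := by
    have : (2 : ℝ) ≤ n₁ := by exact_mod_cast h2
    linarith
  set f : ℕ → ℝ := fun n => (2 * (n : ℝ) * (n + 1) * (2 * n + 1) / 3) * (7 * (n : ℝ) / max D (c₀ * n) ^ 8) with hf
  have hmax : ∀ n : ℕ, 0 < max D (c₀ * n) ^ 8 := fun n => pow_pos (hD.trans_le (le_max_left _ _)) 8
  have hf0 : ∀ n, 0 ≤ f n := fun n => mul_nonneg (by positivity) (div_nonneg (by positivity) (hmax n).le)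
  -- near terms: `max ≥ D`
  have hnear : ∀ n : ℕ, f n ≤ (2 * (n : ℝ) * (n + 1) * (2 * n + 1) / 3) * (7 * (n : ℝ) / D ^ 8) := fun n =>
    mul_le_mul_of_nonneg_left (div_le_div_of_nonneg_left (by positivity) (by positivity)
      (pow_le_pow_left₀ hD.le (le_max_left _ _) 8)) (by positivity)
  -- far terms: `max ≥ c₀ n`, then monotonicity of `(n+1)(2n+1)/n²`
  set C : ℝ := 14 * ((n₁ : ℝ) + 1) * (2 * n₁ + 1) / (3 * c₀ ^ 8 * (n₁ : ℝ) ^ 2) with hC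
  have hC0 : 0 ≤ C := by positivity
  have hfar : ∀ n : ℕ, n₁ ≤ n → f n ≤ C * ((n : ℝ) ^ 4)⁻¹ := by
    intro n hn
    have hn0 : (0 : ℝ) < n := by exact_mod_cast (show 0 < n by omega)
    have hn1r : (n₁ : ℝ) ≤ n := by exact_mod_cast hn
    have h1 : f n ≤ (2 * (n : ℝ) * (n + 1) * (2 * n + 1) / 3) * (7 * (n : ℝ) / (c₀ * n) ^ 8) :=
      mul_le_mul_of_nonneg_left (div_le_div_of_nonneg_left (by positivity) (by positivity)
        (pow_le_pow_left₀ (by positivity) (le_max_right _ _) 8)) (by positivity)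
    have h2' : (2 * (n : ℝ) * (n + 1) * (2 * n + 1) / 3) * (7 * (n : ℝ) / (c₀ * n) ^ 8) =
        14 / (3 * c₀ ^ 8) * (((n : ℝ) + 1) * (2 * n + 1) / (n : ℝ) ^ 2) * ((n : ℝ) ^ 4)⁻¹ := by
      field_simp
      ring
    have h3 : ((n : ℝ) + 1) * (2 * n + 1) / (n : ℝ) ^ 2 ≤ ((n₁ : ℝ) + 1) * (2 * n₁ + 1) / (n₁ : ℝ) ^ 2 := by
      rw [div_le_div_iff₀ (by positivity) (by positivity)]
      nlinarith [mul_nonneg (sub_nonneg.mpr hn1r) (by positivity : (0 : ℝ) ≤ 3 * n * n₁ + n₁ + n)]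
    have h4 : 14 / (3 * c₀ ^ 8) * (((n : ℝ) + 1) * (2 * n + 1) / (n : ℝ) ^ 2) * ((n : ℝ) ^ 4)⁻¹ ≤ C * ((n : ℝ) ^ 4)⁻¹ := by
      have hCe : C = 14 / (3 * c₀ ^ 8) * (((n₁ : ℝ) + 1) * (2 * n₁ + 1) / (n₁ : ℝ) ^ 2) := by
        rw [hC]
        field_simp
      rw [hCe]
      exact mul_le_mul_of_nonneg_right (mul_le_mul_of_nonneg_left h3 (by positivity)) (by positivity)
    exact h1.trans (h2'.le.trans h4)
  have htail : C * (1 / (3 * (((n₁ - 1 : ℕ) : ℝ)) ^ 3)) =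
      14 * ((n₁ : ℝ) + 1) * (2 * n₁ + 1) / (9 * c₀ ^ 8 * (n₁ : ℝ) ^ 2 * ((n₁ : ℝ) - 1) ^ 3) := by
    rw [Nat.cast_sub (by omega : 1 ≤ n₁), Nat.cast_one, hC]
    field_simp
    ring
  by_cases hN : N ≤ n₁
  · have hsub : ∑ n ∈ Finset.Ico nD N, f n ≤ ∑ n ∈ Finset.Ico nD n₁, f n :=
      Finset.sum_le_sum_of_subset_of_nonneg (Finset.Ico_subset_Ico_right hN) fun n _ _ => hf0 n
    have hA := Finset.sum_le_sum fun n (_ : n ∈ Finset.Ico nD n₁) => hnear n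
    have ht0 : (0 : ℝ) ≤ 14 * ((n₁ : ℝ) + 1) * (2 * n₁ + 1) / (9 * c₀ ^ 8 * (n₁ : ℝ) ^ 2 * ((n₁ : ℝ) - 1) ^ 3) := by
      positivity
    linarith
  · have hN' : n₁ ≤ N := by omega
    rw [← Finset.sum_Ico_consecutive f hnD hN']
    have hA := Finset.sum_le_sum fun n (_ : n ∈ Finset.Ico nD n₁) => hnear n
    have hB : ∑ n ∈ Finset.Ico n₁ N, f n ≤ C * ∑ n ∈ Finset.Ico n₁ N, ((n : ℝ) ^ 4)⁻¹ := by
      rw [Finset.mul_sum]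
      exact Finset.sum_le_sum fun n hn => hfar n (Finset.mem_Ico.mp hn).1
    have hS := sum_Ico_inv_pow4_le (n₁ - 1) (by omega) N
    rw [Nat.sub_add_cancel (by omega : 1 ≤ n₁)] at hS
    have hD' := mul_le_mul_of_nonneg_left hS hC0
    rw [htail] at hD'
    linarith

/-- ★★ **THE CLUSTER-ID FAR REMAINDER, CLOSED FORM**: the typed king remainder lemma with its series hypothesis replaced by ONE numeric
inequality — finite part below the split point `n₁` (best `⌈D/c₀⌉`) plus the tail constant; the K-file instantiates at rational `(D, c₀, ϱ)`
by `norm_num` (at `(32, 37/50, 4)`: `nD = 9`, `n₁ = 44`, 35 rational terms). [g99] -/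
theorem schemeDominatedOnP_remainder_king_far {c₀ ϱ ℓ₀ α D θ : ℝ} (hα : 0 < α) (hc : 0 < c₀) {a b : E3} {w : ℤ → E3}
    (hw : IsLayeredCrystal c₀ a b w) (hlip : ∀ m : ℤ, ‖w (m + 1) - w m‖ ≤ ℓ₀) (hϱ : ‖a‖ + ‖b‖ + ℓ₀ ≤ ϱ) (hϱ0 : 0 < ϱ) (hD : 0 < D)
    {nD n₁ : ℕ} (hnD : (nD : ℝ) - 1 ≤ D / ϱ) (h2 : 2 ≤ n₁) (hnD₁ : nD ≤ n₁)
    (hθ : ∑ n ∈ Finset.Ico nD n₁, (2 * (n : ℝ) * (n + 1) * (2 * n + 1) / 3) * (7 * (n : ℝ) / D ^ 8) +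
        14 * ((n₁ : ℝ) + 1) * (2 * n₁ + 1) / (9 * c₀ ^ 8 * (n₁ : ℝ) ^ 2 * ((n₁ : ℝ) - 1) ^ 3) ≤ θ) :
    SchemeDominatedOnP ϱ α a b w kingN kingZ (fun x => D < ‖bondVec a b w x‖) (fun _ => (1 + α) * θ) (fun _ => (1 + α⁻¹) * θ) :=
  schemeDominatedOnP_remainder_king_typed hα hc hw hlip hϱ hϱ0 hD hnD fun N => (king_typed_series_le hD hc h2 hnD₁ N).trans hθ

end Summit.AtomisticToContinuum.Crystallization.Theorems.ChartedZeroExcessLayeredLatticeLiouville
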